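import Summits.HodgeConjecture.HodgeCM.Automorphic.AdelicTorusThetaData_1

/-! PORT of `HodgeCM/Automorphic/AdelicTorusThetaData.lean` (HodgeCMPerL run 82) — part 2: continuation of `Summits.HodgeConjecture.HodgeCM.Automorphic.AdelicTorusThetaData_1` (split at a top-level declaration boundary by port_pkg.py; scope re-opened below; declarations unchanged). -/

-- port_pkg: scope re-opened for this part (file-level context, then the namespace/section stack open at the cut)
set_option autoImplicit false
noncomputable section
open NumberField IsDedekindDomain TopologicalSpace MeasureTheory
open scoped Topology Matrix CompactlySupported
namespace HodgeCM
open Literature.AlgebraicGeometry.ShimuraVarieties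
namespace Universe
open HodgeCM.PerL34 HodgeCM.PerL34.Annihilation HodgeCM.Adelic
open HodgeCM.Prior.Perl34File HodgeCM.Prior.Perl34File.Perl34
variable (U : Universe)
/-- **Theta data with PerL's TORI**: HANDOVER #5b's `AdelicModelThetaData hP` with, per context,
`T₁₂(𝔸) = T₃₄(𝔸) := SeesawTorus L⁺ L` (pv11-g5: group, topology, Hausdorff, local compactness, Borel
σ-algebra all CONSTRUCTED), their Haar measures `SeesawTorus.haar` and their embeddings `jT₁₂`, `jT₃₄` into the
model group of `U(W)` (§9) — none of them DATA any more. -/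
structure AdelicTorusThetaData (hP : PrintFact_unitaryCompact) where
  /-- degree-two classes of `P_Γ` as `L²` functions on `[G_U]` -/
  emb : ∀ {L : CMField} {ι₁ : L →+* ℂ} {V : HermSpace3 L ι₁} (Γ : Level V),
    U.CohC (U.pms L ι₁ V Γ) 2 →ₗ[ℂ] (V.latticeModel hP).toQuotientModel.H
  /-- the covering `P_{Γ'} → P_Γ` for `Γ' ≤ Γ` -/
  cover : ∀ {L : CMField} {ι₁ : L →+* ℂ} {V : HermSpace3 L ι₁} (Γ Γ' : Level V),
    Γ'.Γ ≤ Γ.Γ → U.Mor (U.pms L ι₁ V Γ') (U.pms L ι₁ V Γ)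
  /-- sign recipe, first half -/
  kappa : ∀ (K L : CMField), (K →+* L) → (L →+* ℂ) → (L →+* ℂ) → (K →+* ℂ)
  /-- sign recipe, second half -/
  frameSign : ∀ (L : CMField), (L →+* ℂ) → (L →+* ℂ) → Bool
  /-- the Weil theta model of the context, over the adelic unitary groups -/
  wm : ∀ {L : CMField} {ι₁ : L →+* ℂ} (V : HermSpace3 L ι₁) (c : SeesawCtx L),
    WeilThetaModel (V.latticeModel hP).toQuotientModel.G (V.latticeModel hP).toQuotientModel.Γ
      (c.D.latticeModelW hP).toQuotientModel.G (c.D.latticeModelW hP).toQuotientModel.Γ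
  /-- the (12) torus-side carrier data over `T₁₂(𝔸) = SeesawTorus L⁺ L` -/
  tr12 : ∀ {L : CMField} {ι₁ : L →+* ℂ} (V : HermSpace3 L ι₁) (c : SeesawCtx L),
    TorusCarrierRest
      (KernelModel.core (V.latticeModel hP).toQuotientModel (c.D.latticeModelW hP).toQuotientModel (wm V c).SK
        (wm V c).omg (wm V c).θ) (SeesawTorus (maximalRealSubfield (L : Type)) L)
  /-- the (34) torus-side carrier data over `T₃₄(𝔸) = SeesawTorus L⁺ L` -/
  tr34 : ∀ {L : CMField} {ι₁ : L →+* ℂ} (V : HermSpace3 L ι₁) (c : SeesawCtx L),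
    TorusCarrierRest
      (KernelModel.core (V.latticeModel hP).toQuotientModel (c.D.latticeModelW hP).toQuotientModel (wm V c).SK
        (wm V c).omg (wm V c).θ) (SeesawTorus (maximalRealSubfield (L : Type)) L)
  /-- the theta one-forms of type `Ψ_i` at level `Γ` -/
  Theta : ∀ {L : CMField} {ι₁ : L →+* ℂ} (V : HermSpace3 L ι₁), SeesawCtx L → Fin 4 → ∀ Γ : Level V,
    Set (U.CohC (U.pms L ι₁ V Γ) 1)

namespace AdelicTorusThetaData

variable {U} {hP : PrintFact_unitaryCompact} (D : U.AdelicTorusThetaData hP)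

/-- **The adelic-model theta data of a torus one**: `T12 = T34 := SeesawTorus L⁺ L` with pv11-g5's instances,
`kt12 := tr12 + SeesawTorus.haar + jT₁₂Model`, `kt34 := tr34 + SeesawTorus.haar + jT₃₄Model`.  Reducible. -/
abbrev toAdelicModelThetaData : U.AdelicModelThetaData hP where
  emb := D.emb
  cover := D.cover
  kappa := D.kappa
  frameSign := D.frameSign
  wm := D.wm
  T12 := fun {L} _ _ _ => SeesawTorus (maximalRealSubfield (L : Type)) L
  T34 := fun {L} _ _ _ => SeesawTorus (maximalRealSubfield (L : Type)) L
  kt12 := fun {L} _ V c =>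
    (D.tr12 V c).toKernelTorusCarrier (SeesawTorus.haar (maximalRealSubfield (L : Type)) L) (c.D.jT₁₂Model hP)
  kt34 := fun {L} _ V c =>
    (D.tr34 V c).toKernelTorusCarrier (SeesawTorus.haar (maximalRealSubfield (L : Type)) L) (c.D.jT₃₄Model hP)
  instν12 := fun {L} _ _ _ => SeesawTorus.isFiniteMeasureOnCompacts_haar (maximalRealSubfield (L : Type)) L
  instν34 := fun {L} _ _ _ => SeesawTorus.isFiniteMeasureOnCompacts_haar (maximalRealSubfield (L : Type)) L
  Theta := D.Theta

/-- (Ported verbatim from the HodgeCMPerL package; no docstring in the source.) -/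
@[simp] theorem T12_eq {L : CMField} {ι₁ : L →+* ℂ} (V : HermSpace3 L ι₁) (c : SeesawCtx L) :
    D.toAdelicModelThetaData.T12 V c = SeesawTorus (maximalRealSubfield (L : Type)) L := rfl

/-- (Ported verbatim from the HodgeCMPerL package; no docstring in the source.) -/
@[simp] theorem T34_eq {L : CMField} {ι₁ : L →+* ℂ} (V : HermSpace3 L ι₁) (c : SeesawCtx L) :
    D.toAdelicModelThetaData.T34 V c = SeesawTorus (maximalRealSubfield (L : Type)) L := rfl

/-- (Ported verbatim from the HodgeCMPerL package; no docstring in the source.) -/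
@[simp] theorem kt12_ν {L : CMField} {ι₁ : L →+* ℂ} (V : HermSpace3 L ι₁) (c : SeesawCtx L) :
    (D.toAdelicModelThetaData.kt12 V c).ν = SeesawTorus.haar (maximalRealSubfield (L : Type)) L := rfl

/-- (Ported verbatim from the HodgeCMPerL package; no docstring in the source.) -/
@[simp] theorem kt34_ν {L : CMField} {ι₁ : L →+* ℂ} (V : HermSpace3 L ι₁) (c : SeesawCtx L) :
    (D.toAdelicModelThetaData.kt34 V c).ν = SeesawTorus.haar (maximalRealSubfield (L : Type)) L := rfl

/-- (Ported verbatim from the HodgeCMPerL package; no docstring in the source.) -/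
@[simp] theorem kt12_jT {L : CMField} {ι₁ : L →+* ℂ} (V : HermSpace3 L ι₁) (c : SeesawCtx L) :
    (D.toAdelicModelThetaData.kt12 V c).jT = c.D.jT₁₂Model hP := rfl

/-- (Ported verbatim from the HodgeCMPerL package; no docstring in the source.) -/
@[simp] theorem kt34_jT {L : CMField} {ι₁ : L →+* ℂ} (V : HermSpace3 L ι₁) (c : SeesawCtx L) :
    (D.toAdelicModelThetaData.kt34 V c).jT = c.D.jT₃₄Model hP := rfl

/-- The lattice `T(L₀)` goes to the model lattice under both embeddings (PerL: `T(L₀) ⊂ U(W)(L₀)`). -/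
theorem rat_le_comap_kt12_jT {L : CMField} {ι₁ : L →+* ℂ} (V : HermSpace3 L ι₁) (c : SeesawCtx L) :
    SeesawTorus.rat (maximalRealSubfield (L : Type)) L ≤
      (c.D.latticeModelW hP).Γ.comap (D.toAdelicModelThetaData.kt12 V c).jT.toMonoidHom :=
  c.D.rat_le_comap_jT₁₂Model hP

/-- (Ported verbatim from the HodgeCMPerL package; no docstring in the source.) -/
theorem rat_le_comap_kt34_jT {L : CMField} {ι₁ : L →+* ℂ} (V : HermSpace3 L ι₁) (c : SeesawCtx L) :
    SeesawTorus.rat (maximalRealSubfield (L : Type)) L ≤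
      (c.D.latticeModelW hP).Γ.comap (D.toAdelicModelThetaData.kt34 V c).jT.toMonoidHom :=
  c.D.rat_le_comap_jT₃₄Model hP

end AdelicTorusThetaData

end Universe

/-! ### END STATE with PerL's tori -/

namespace Assembly

open HodgeCM.PerL34 HodgeCM.PerL34.Annihilation
open HodgeCM.Prior.Perl34File HodgeCM.Prior.Perl34File.Perl34
open HodgeCM.Universe (AdelicTorusThetaData AdelicModelThetaData LatticeModelThetaData WeilModelThetaData
  KernelModelThetaData ThetaModel)

variable (U : Universe)

/-- **Both realisation inputs of part (a) — `RealisationExistsPerL ∧ RealisationExistsFace` — over the ADELIC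
UNITARY GROUPS with PerL's TORI.**  As `realisationExists_ofAdelicModelData`, with the tori `T₁₂(𝔸), T₃₄(𝔸)`,
their Haar measures and their embeddings into `U(W)(𝔸)` no longer data. -/
theorem realisationExists_ofAdelicTorusData (M : U.ModelAxioms) (hP : PrintFact_unitaryCompact)
    (D : U.AdelicTorusThetaData hP)
    (A12 : ∀ {L : CMField} {ι₁ : L →+* ℂ} (V : HermSpace3 L ι₁) (c : SeesawCtx L),
      QuotientTorusDatum (D.toAdelicModelThetaData.toLatticeModelThetaData.lat V c).toQuotientModel.ν
        (D.toAdelicModelThetaData.toLatticeModelThetaData.toWeilModelThetaData.toKernelModelThetaData.kcore V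
          c).toRegCoreCarrier.toRepCoreCarrier
        (D.toAdelicModelThetaData.kt12 V c).toRegTorusCarrier.toRepTorusCarrier)
    (A34 : ∀ {L : CMField} {ι₁ : L →+* ℂ} (V : HermSpace3 L ι₁) (c : SeesawCtx L),
      QuotientTorusDatum (D.toAdelicModelThetaData.toLatticeModelThetaData.lat V c).toQuotientModel.ν
        (D.toAdelicModelThetaData.toLatticeModelThetaData.toWeilModelThetaData.toKernelModelThetaData.kcore V
          c).toRegCoreCarrier.toRepCoreCarrier
        (D.toAdelicModelThetaData.kt34 V c).toRegTorusCarrier.toRepTorusCarrier)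
    (A : (ThetaModel.ofRegCarrier
      D.toAdelicModelThetaData.toLatticeModelThetaData.toWeilModelThetaData.toKernelModelThetaData.toKernelThetaCarrier.toRegThetaCarrier
      (D.toAdelicModelThetaData.toLatticeModelThetaData.analyticKM_of_quotientData A12 A34).toAnalytic).Inputs)
    (hHR : U.Fact_hodgeRiemann20) : U.RealisationExistsPerL ∧ U.RealisationExistsFace :=
  realisationExists_ofAdelicModelData U M hP D.toAdelicModelThetaData A12 A34 A hHR

/-- **PerL over the adelic unitary groups with PerL's tori.** -/
theorem perL_ofAdelicTorusData (M : U.ModelAxioms) (hP : PrintFact_unitaryCompact)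
    (D : U.AdelicTorusThetaData hP)
    (A12 : ∀ {L : CMField} {ι₁ : L →+* ℂ} (V : HermSpace3 L ι₁) (c : SeesawCtx L),
      QuotientTorusDatum (D.toAdelicModelThetaData.toLatticeModelThetaData.lat V c).toQuotientModel.ν
        (D.toAdelicModelThetaData.toLatticeModelThetaData.toWeilModelThetaData.toKernelModelThetaData.kcore V
          c).toRegCoreCarrier.toRepCoreCarrier
        (D.toAdelicModelThetaData.kt12 V c).toRegTorusCarrier.toRepTorusCarrier)
    (A34 : ∀ {L : CMField} {ι₁ : L →+* ℂ} (V : HermSpace3 L ι₁) (c : SeesawCtx L),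
      QuotientTorusDatum (D.toAdelicModelThetaData.toLatticeModelThetaData.lat V c).toQuotientModel.ν
        (D.toAdelicModelThetaData.toLatticeModelThetaData.toWeilModelThetaData.toKernelModelThetaData.kcore V
          c).toRegCoreCarrier.toRepCoreCarrier
        (D.toAdelicModelThetaData.kt34 V c).toRegTorusCarrier.toRepTorusCarrier)
    (A : (ThetaModel.ofRegCarrier
      D.toAdelicModelThetaData.toLatticeModelThetaData.toWeilModelThetaData.toKernelModelThetaData.toKernelThetaCarrier.toRegThetaCarrier
      (D.toAdelicModelThetaData.toLatticeModelThetaData.analyticKM_of_quotientData A12 A34).toAnalytic).Inputs)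
    (hHR : U.Fact_hodgeRiemann20) : U.PerL :=
  perL_ofAdelicModelData U M hP D.toAdelicModelThetaData A12 A34 A hHR

/-- **COR-CM, END STATE over the adelic unitary groups with PerL's tori.** -/
theorem COR_CM_endState_ofAdelicTorusData (M : U.ModelAxioms) (h29 : U.Fact_weightSpan)
    (h30 : U.Fact_weightHodge) (hE : U.Qw8ExtProd) (hD : U.Qw8DualPushPull) (hMi : U.Qw8Milne)
    (hP : PrintFact_unitaryCompact) (D : U.AdelicTorusThetaData hP)
    (A12 : ∀ {L : CMField} {ι₁ : L →+* ℂ} (V : HermSpace3 L ι₁) (c : SeesawCtx L),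
      QuotientTorusDatum (D.toAdelicModelThetaData.toLatticeModelThetaData.lat V c).toQuotientModel.ν
        (D.toAdelicModelThetaData.toLatticeModelThetaData.toWeilModelThetaData.toKernelModelThetaData.kcore V
          c).toRegCoreCarrier.toRepCoreCarrier
        (D.toAdelicModelThetaData.kt12 V c).toRegTorusCarrier.toRepTorusCarrier)
    (A34 : ∀ {L : CMField} {ι₁ : L →+* ℂ} (V : HermSpace3 L ι₁) (c : SeesawCtx L),
      QuotientTorusDatum (D.toAdelicModelThetaData.toLatticeModelThetaData.lat V c).toQuotientModel.ν
        (D.toAdelicModelThetaData.toLatticeModelThetaData.toWeilModelThetaData.toKernelModelThetaData.kcore V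
          c).toRegCoreCarrier.toRepCoreCarrier
        (D.toAdelicModelThetaData.kt34 V c).toRegTorusCarrier.toRepTorusCarrier)
    (A : (ThetaModel.ofRegCarrier
      D.toAdelicModelThetaData.toLatticeModelThetaData.toWeilModelThetaData.toKernelModelThetaData.toKernelThetaCarrier.toRegThetaCarrier
      (D.toAdelicModelThetaData.toLatticeModelThetaData.analyticKM_of_quotientData A12 A34).toAnalytic).Inputs)
    (hHR : U.Fact_hodgeRiemann20) : U.HC_CM :=
  COR_CM_endState_ofAdelicModelData U M h29 h30 hE hD hMi hP D.toAdelicModelThetaData A12 A34 A hHR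

end Assembly

end HodgeCM

end
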